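import Summits.BirchSwinnertonDyer.BirchSwinnertonDyer.Theorems.ResidualThetaTransportAtTwoResidualSignedLambdaLowerCMAtTwoCofreeSelmerTransferRelaxed
import HarnessLib

/-!
# (M) for item 7 (S4₀): a level class STRICT at `v ∣ p` transfers to a SelRel₍C4₎ test class with every conjugate in `awayKer`

Route `ResidualThetaTransportAtTwo` (RTT), crux RSL_g `ResidualSignedLambdaLowerCMAtTwo` (stmt-BirchSwinnertonDyer-22608), line «onepair», split item
S4₀ `stub_deepHalfAwayTwo` (R12 item 7: test classes `s : ↥SelRel` under the guard «`loc₂`-datum of `s` trivial»; S89: its interior transfer is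
`transferH1_mem_relaxed_strict_of_shapiroLift`); seat `prover-bsd-wall-tp2-p2x-w2` g19 (`--supports`, closes nothing). THEOREMS ONLY (no definition,
no named fact, no instance, no `sorry`). BSD is not proved by any of this; RSL_g (22608) stays OPEN.

**`transferH1_mem_selRel_strict_of_shapiroLift`**: [unr] ∧ [inf] ∧ [p] `loc_v (Sh c) = 0` at every `v ∋ p` (the dual conditions of tp2-p2x LEAD
g18's S4₀ socket `…DeepHalfAwayTwoLevelwise`) ⟹ the transferred class `τ_n c` lies in SelRel₍C4₎'s literal (its tower-Kummer clause at `v ∋ p`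
holds with the ZERO datum `(ψ, Q := 0, k := 0)`, `ψ` a representative of `conj_σ (τ_n c)` VANISHING on `Γ_∞ ∩ D_v`; ANY transport family `Θ`) AND
every conjugate of `τ_n c` lies in `awayKer Γ_∞ A_ρ v` — the (M)-input of GLUE-7 for S4₀ (the readback of `Σ_{w,c} χ w c (locAway s w c)` to the
level sum waits for the AwayTwo frame, AWAYTWO-FRAME-g18).

References: [GreenbergVatsal2000] §2 pp. 16–17, 23; [Greenberg1989] §1 p. 98 (3); [SerreGaloisCohomology1997] I §2.6 (b); [Kobayashi2003] Def. 1.1.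
-/

set_option autoImplicit false
-- the Theorems namespace of this sub repeats the summit name by design (D-0017 nested layout)
set_option linter.dupNamespace false

noncomputable section

open scoped Classical NumberField

namespace Summit.BirchSwinnertonDyer.BirchSwinnertonDyer.Theorems.ThetaTransport.CofreeSelmerTransfer

open CategoryTheory Field NumberField IsDedekindDomain
  Literature.NumberTheory.EllipticCurves Literature.NumberTheory.GaloisRepresentations
  Literature.NumberTheory.EllipticCurves.Kobayashi2003 Literature.NumberTheory.EllipticCurves.GreenbergVatsal2000
  Literature.NumberTheory.EllipticCurves.GreenbergSelmer Literature.NumberTheory.EllipticCurves.CyclotomicLayer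
  Literature.NumberTheory.EllipticCurves.Sprung2012
  Literature.NumberTheory.GaloisCohomology ZpExtension
  Literature.NumberTheory.GaloisRepresentations.DiscreteGaloisModule
  Summit.BirchSwinnertonDyer.BirchSwinnertonDyer.Theorems

variable {p : ℕ} [Fact p.Prime] (S : Set (PadicAlgCl p)) {d : ℕ} (ρ : FramedGaloisRep ℚ ↥(padicCoeffIntegers S) d)
  (k : ℕ) (W : WeierstrassCurve ℚ) {r : ℕ} (κ : ZpExtension ℚ p) (n : ℕ)
  (Θ : ∀ v : HeightOneSpectrum (𝓞 ℚ), (p : 𝓞 ℚ) ∈ v.asIdeal →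
    (Cofree ρ ↥(padicCoeffField S) ≃+ (Fin r → ↥(W.geomPrimaryTorsion p))))
  [Fintype (absoluteGaloisGroup ℚ ⧸ κ.layerSubgroup n)]
  {s : absoluteGaloisGroup ℚ ⧸ κ.layerSubgroup n → absoluteGaloisGroup ℚ}
  (hs : ∀ x : absoluteGaloisGroup ℚ ⧸ κ.layerSubgroup n, (s x : absoluteGaloisGroup ℚ ⧸ κ.layerSubgroup n) = x)
  (hs1 : s ((1 : absoluteGaloisGroup ℚ) : absoluteGaloisGroup ℚ ⧸ κ.layerSubgroup n) = 1)
  {S₀ : Set (HeightOneSpectrum (𝓞 ℚ))}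

/-- **(M) for item 7 (S4₀, the guard `loc₂ s = 0`).** [unr] ∧ [inf] ∧ [p] `loc_v (Sh c) = 0` at every `v ∋ p` ⟹ the transferred class `τ_n c`
lies in SelRel₍C4₎'s literal — its tower-Kummer clause at `v ∋ p` holds with the ZERO datum `(ψ, Q := 0, k := 0)`, `ψ` a representative of
`conj_σ (τ_n c)` VANISHING on `Γ_∞ ∩ D_v` (`exists_rep_vanishing_conjH1_transferH1`), for ANY transport family `Θ` — AND every conjugate of
`τ_n c` lies in `awayKer Γ_∞ A_ρ v` (S4₀'s guard in its strongest Galois-side form; `transferH1_mem_relaxed_strict_of_shapiroLift`, S89).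
[cite: GreenbergVatsal2000, §2 pp. 16–17, 23] [cite: Greenberg1989, §1 p. 98] [cite: SerreGaloisCohomology1997, I §2.6 (b)] -/
theorem transferH1_mem_selRel_strict_of_shapiroLift
    (hρ : ∀ w : HeightOneSpectrum (𝓞 ℚ), w ∉ S₀ → ((p : ℕ) : 𝓞 ℚ) ∉ w.asIdeal → ρ.IsUnramifiedAt w)
    (c : H1 (cofreeTorsionGaloisModule S ρ ((p ^ k : ℕ) : ℤ)) (κ.layerSubgroup n))
    (hur : ∀ w : HeightOneSpectrum (𝓞 ℚ), w ∉ S₀ → ((p : ℕ) : 𝓞 ℚ) ∉ w.asIdeal →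
      galoisCohomology.localization
          ((cofreeTorsionGaloisModule S ρ ((p ^ k : ℕ) : ℤ)).coind (κ.layerSubgroup n) (κ.isOpen_layerSubgroup n)) (Sum.inr w) 1
          (shapiroLift (cofreeTorsionGaloisModule S ρ ((p ^ k : ℕ) : ℤ)).toTopRep (κ.layerSubgroup n) (κ.isOpen_layerSubgroup n)
            hs hs1 c) ∈
        unramifiedSubgroup (GaloisRep.toLocal w
          ((cofreeTorsionGaloisModule S ρ ((p ^ k : ℕ) : ℤ)).coind (κ.layerSubgroup n) (κ.isOpen_layerSubgroup n))) 1)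
    (hinf : ∀ w : InfinitePlace ℚ,
      galoisCohomology.localization
          ((cofreeTorsionGaloisModule S ρ ((p ^ k : ℕ) : ℤ)).coind (κ.layerSubgroup n) (κ.isOpen_layerSubgroup n)) (Sum.inl w) 1
          (shapiroLift (cofreeTorsionGaloisModule S ρ ((p ^ k : ℕ) : ℤ)).toTopRep (κ.layerSubgroup n) (κ.isOpen_layerSubgroup n)
            hs hs1 c) = 0)
    (hp : ∀ v : HeightOneSpectrum (𝓞 ℚ), ((p : ℕ) : 𝓞 ℚ) ∈ v.asIdeal →
      galoisCohomology.localization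
          ((cofreeTorsionGaloisModule S ρ ((p ^ k : ℕ) : ℤ)).coind (κ.layerSubgroup n) (κ.isOpen_layerSubgroup n)) (Sum.inr v) 1
          (shapiroLift (cofreeTorsionGaloisModule S ρ ((p ^ k : ℕ) : ℤ)).toTopRep (κ.layerSubgroup n) (κ.isOpen_layerSubgroup n)
            hs hs1 c) = 0) :
    resOfLe (Cofree ρ ↥(padicCoeffField S)) (κ.kerSubgroup_le_layerSubgroup n)
        (pushH1 (κ.layerSubgroup n) (AddSubgroup.torsionBy (Cofree ρ ↥(padicCoeffField S)) ((p ^ k : ℕ) : ℤ)).subtype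
          (torsionBy_subtype_smul S ρ ((p ^ k : ℕ) : ℤ)) c) ∈
      {y : subgroupH1 κ.kerSubgroup (Cofree ρ ↥(padicCoeffField S)) |
        y ∈ unramifiedOutside κ.kerSubgroup (Cofree ρ ↥(padicCoeffField S)) p S₀ ∧
        (∀ w σ, conjH1 κ.kerSubgroup (Cofree ρ ↥(padicCoeffField S)) σ y ∈
          infKer κ.kerSubgroup (Cofree ρ ↥(padicCoeffField S)) w) ∧
        ∀ (v' : HeightOneSpectrum (𝓞 ℚ)) (hv' : (p : 𝓞 ℚ) ∈ v'.asIdeal) (σ : absoluteGaloisGroup ℚ),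
          ∃ (φ : contOneCocycles (discreteTopRep κ.kerSubgroup (Cofree ρ ↥(padicCoeffField S))))
            (Q : Fin r → localPoints W (v'.adicCompletion ℚ)) (k' : ℕ),
            oneCocycleClass (discreteTopRep κ.kerSubgroup (Cofree ρ ↥(padicCoeffField S))) φ =
              conjH1 κ.kerSubgroup (Cofree ρ ↥(padicCoeffField S)) σ y ∧
            (∀ i, (p ^ k') • Q i ∈ localTowerPointsOfEmb κ (closureEmb (K := ℚ) (v'.adicCompletion ℚ)) W) ∧
            ∀ (τ : localSubgroupOfEmb κ.kerSubgroup (closureEmb (K := ℚ) (v'.adicCompletion ℚ))) (i : Fin r),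
              pointsMapOfEmb W (closureEmb (K := ℚ) (v'.adicCompletion ℚ))
                  ((Θ v' hv' (φ.1 (resGalSubgroupOfEmb κ.kerSubgroup (closureEmb (K := ℚ) (v'.adicCompletion ℚ)) τ)) i :
                    ↥(W.geomPrimaryTorsion p)) : W.geomPoints) =
                (τ : absoluteGaloisGroup (v'.adicCompletion ℚ)) • Q i - Q i} ∧
      ∀ v, ((p : ℕ) : 𝓞 ℚ) ∈ v.asIdeal → ∀ σ,
        conjH1 κ.kerSubgroup (Cofree ρ ↥(padicCoeffField S)) σ
            (resOfLe (Cofree ρ ↥(padicCoeffField S)) (κ.kerSubgroup_le_layerSubgroup n)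
              (pushH1 (κ.layerSubgroup n) (AddSubgroup.torsionBy (Cofree ρ ↥(padicCoeffField S)) ((p ^ k : ℕ) : ℤ)).subtype
                (torsionBy_subtype_smul S ρ ((p ^ k : ℕ) : ℤ)) c)) ∈
          awayKer κ.kerSubgroup (Cofree ρ ↥(padicCoeffField S)) v := by
  obtain ⟨h1, h2, h3⟩ := transferH1_mem_relaxed_strict_of_shapiroLift S ρ κ ((p ^ k : ℕ) : ℤ) n hs hs1 hρ c hur hinf hp
  refine ⟨⟨h1, h2, fun v' hv' σ ↦ ?_⟩, h3⟩
  obtain ⟨ψ, hψ, h0⟩ := exists_rep_vanishing_conjH1_transferH1 S ρ κ ((p ^ k : ℕ) : ℤ) n v' σ c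
    (ShapiroTransport.resOfLe_decomp_conjH1_eq_zero_of_localization_shapiroLift_eq_zero S ρ _ κ n hs hs1 v' c (hp v' hv') σ)
  refine ⟨ψ, 0, 0, hψ, fun i ↦ ?_, fun τ i ↦ ?_⟩
  · rw [Pi.zero_apply, smul_zero]
    exact zero_mem _
  · rw [h0 _ (Kobayashi2003.resGalOfEmb_mem_decomp v' (τ : absoluteGaloisGroup (v'.adicCompletion ℚ))), map_zero,
      Pi.zero_apply, ZeroMemClass.coe_zero, map_zero, Pi.zero_apply, smul_zero, sub_zero]

end Summit.BirchSwinnertonDyer.BirchSwinnertonDyer.Theorems.ThetaTransport.CofreeSelmerTransfer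

end
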